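import Summits.BirchSwinnertonDyer.BirchSwinnertonDyer.Theses.SignedLowerHalves
import Summits.BirchSwinnertonDyer.Rank1Residual.Supersingular.KobayashiMainConjecture
import Literature.NumberTheory.EllipticCurves.Rank1Residual.Typed.X7
import Literature.NumberTheory.EllipticCurves.KuriharaNumberInvariants
import Literature.NumberTheory.EllipticCurves.Tamagawa
import Literature.NumberTheory.EllipticCurves.Fouquet2025.CongruenceTransportAnyReduction
import Mathlib.NumberTheory.Cyclotomic.PrimitiveRoots
import HarnessLib

/-!
# Line `stable-twist-seed` — crux `KobayashiLowerHalfLargeImage` (route SignedLowerHalves, item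
# stmt-BirchSwinnertonDyer-19001, rank 3): kill the Selmer group by a Diophantine-stable ORDER-`p` TWIST
# `A_χ = E ⊗ χ` (conductor of `χ` = a product of Mazur–Rubin «useful» primes; Klagsbrun–Mazur–Rubin),
# decide the signed main conjectures for the twist `f ⊗ χ` AT `T = 0` — Kato's divisibility for `f ⊗ χ`
# plus ONE exact twisted `L`-value `v_𝔭 𝓛(E,χ̄) = ν(n) + (p-1)·ord_p Tam(E)` (the value BSD(`A_χ`) forces,
# `Sel_𝔭(A_χ/ℚ) = 0`) — and carry them back to `f` along the congruence `f ⊗ χ ≡ f (mod 𝔭 = (1-ζ_p))`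
# (Fouquet 2025 Thm 4.1, Ass. 3.4 (5)(b)/(c) automatic at the twisting primes; or signed Greenberg–Vatsal).

HONEST FRAMING (D-0152): this line feeds the CLASS route K3 = `SignedLowerHalves`; nothing here proves
BSD; every stub is `sorry`; the composition only shows that the stubs, if proved, give the crux BY NAME.
Idea card: `Cruxes/KobayashiLowerHalfLargeImage/Ideas/stable-twist-seed.md` (crux-ideate k1 g22, 2026-08-28).
No Kolyvagin-system rigidity theorem (Mazur–Rubin 5.3.10 / KKS / Kim 2026 / Castella–Sano PRE) is invoked.

Vocabulary (this file): `zetaP p = ζ_p ∈ ℚ(ζ_p) = CyclotomicField p ℚ`; `twistedThetaValue f p n ψ =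
Σ_{a ∈ (ℤ/n)ˣ} [a/n]⁺_f · ζ_p^{Σ_ℓ ψ_ℓ(a)}` = `χ_ψ(θ_n)`, the image of the Mazur–Tate element of level `n`
under the order-`p` character `χ_ψ = ζ_p^{Σψ_ℓ}` (fully ramified at every `ℓ ∣ n` when each `ψ_ℓ` is onto;
same summand shape as the tree's `kuriharaNumber`); `HasPrimeValuation p x e` = «`v_{(1-ζ_p)}(x) = e`»
spelled without valuation API (`D·x = (1-ζ)^e·y`, `p ∤ D`, `y ∈ ℤ[ζ] ∖ (1-ζ)ℤ[ζ]`); `IsStableTwistLevel W p n`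
= `n` is a CYCLIC Kolyvagin level (`IsCyclicKolyvaginLevel`: square-free, `ℓ ∤ Np`, `ℓ ≡ 1`, `a_ℓ ≡ 2 (mod p)`,
`Ẽ(𝔽_ℓ)[p]` cyclic ⟺ `Frob_ℓ` of order exactly `p` on `E[p]` = KMR's `𝒫₁`) at whose primes `p` and every
`q ∣ N` are `p`-th powers (so `p` and the bad primes split completely in `ℚ(χ_ψ)`: `a_p(f⊗χ) = 0` with the
SAME local Galois representation at `p`, and `A_χ ≅ E ⊗ ℤ[ζ_p]` at every bad prime); `StableTwistWitness W p f`
= ∃ such `(n, ψ)` with `v_𝔭 χ_ψ(θ_n) = ν(n) + (p-1)·ord_p ∏ c_ℓ` EXACTLY.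

Stubs (4):
* `stub_stableTwistExact` — THE HARD STUB (class-wide, `p ≥ 5`): every pair of the corner has a stable twist
  witness. WHY PLAUSIBLY TRUE: by Čebotarev in `ℚ(E[p], ζ_p, p^{1/p}, q^{1/p} : q ∣ N, Sel)` (disjointness from
  `SL₂(𝔽_p)` perfect, `p ≥ 5`) there are stable levels `n = ℓ₁⋯ℓ_s`, `s = dim Sel_p(E)`, killing the Selmer group
  one useful prime at a time (KMR 2014 Prop 46(ii), 47(ii)), so `Sel_𝔭(A_χ/ℚ) = 0`, rank `0`, `Ш(A_χ)[𝔭^∞] = 0`;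
  BSD for the abelian variety `A_χ/ℚ` (Dokchitser–Evans–Wiersema Conj. 4 for `(E,χ)`) then predicts EXACTLY
  `v_𝔭 𝓛(E,χ̄) = Σ_i length Φ_{ℓ_i}(𝔽_ℓ)[𝔭] + Σ_{q∣N} (p-1)·ord_p c_q + 0 = ν(n) + (p-1)t` (torsion `A_χ(ℚ)[𝔭] =
  E(ℚ)[p] = 0` by `Surj`; `Φ_{ℓ_i}(𝔽_{ℓ_i}) ≅ Ẽ(𝔽_{ℓ_i})[p] ≅ ℤ/p`; no `p`-adic multiplier at supersingular `p`).
  Conversely the exact value FORCES `Sel_{𝔭^∞}(A_χ) = 0` through Kato's inequality, so no descent is ever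
  computed. Per pair: ONE finite modular-symbol computation. Class-wide: BSD(`A_χ`)-strength, OPEN.
* `stub_signedMC_of_stableTwist_fouquet` — ENGINE + TRANSPORT (published inputs; sizes L/XL to type):
  (i) Kato 2004 Thm 12.5 for the newform `f⊗χ` (coefficients `ℚ(ζ_p)`, prime `𝔭`; integral since
  `ρ_f(G_{ℚ(χ)}) ⊇ SL₂(ℤ_p)`) + Kobayashi 2003 Thm 1.2/1.3 & (3.5)–(3.6), Lei 2011 (`a_p(f⊗χ) = 0`, `χ(p) = 1`):
  `char X^ε(f⊗χ) ∣ ϖ·L^ε_p(f⊗χ)`; (ii) B. D. Kim 2013 (`±` control at `T = 0`, no finite submodules; Hatley–Lei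
  2019 Thm 3.1): `v_𝔭 (char X^ε)(0) = ν(n) + (p-1)t` because `Sel_{𝔭^∞}(A_χ/ℚ) = 0`; (iii) interpolation
  `L^+_p(0) = (p-1)·𝓛`, `L^-_p(0) = 2·𝓛` and the witness ⇒ the quotient is a unit
  (`Sketch.lean: span_eq_of_dvd_of_associated_constantCoeff`, PROVED) ⇒ BOTH signed main conjectures for `f⊗χ`;
  (iv) Fouquet 2025 Thm 4.1 (1)⇒(2) in `T^Σ_𝔪ρ̄`, `Σ ⊇ primes(nNp)`, seed = the motivic point `f⊗χ ≡ f mod 𝔭`: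
  Ass. 2.9 ⇐ `Surj` ∧ supersingular; Ass. 3.4 at `ℓ ∣ n` holds by case (5)(b) «`ρ̄|I_ℓ` scalar, `ρ̄(Fr ℓ)` NOT
  diagonalizable» (a transvection!) and by (5)(c) «type = twist by a character» (AUTOMATIC; p. 22–23),
  at `W`'s `ρ̄`-unramified Tate primes it is the hypothesis `Assumption34TateAt p W`
  ⇒ Kato's IMC for `f` ⇒ (Kobayashi Thm 7.4, `a_p = 0`) `KobayashiMainConjecture W p ε` for every `ε`.
* `stub_lowerHalf_of_stableTwist_ineligible` — the Fouquet-INELIGIBLE pairs (`¬ Assumption34TateAt p W`: some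
  unramified Tate prime `q ≡ 1 (p)` with `p`-th-power Tate unit): (i)–(iii) as above, then SIGNED RESIDUAL
  transport `f⊗χ ⇝ f` (`A_χ[𝔭] ≅ E[p]`, same `±` condition at `p`; B. D. Kim 2009, Hatley–Lei 2019 Thm 4.6,
  Ray–Sujatha 2023 Thm 4.5; the analytic `λ`-congruence of `Σ₀`-imprimitive `±` `p`-adic `L`-functions is
  termwise) which needs `μ(ϖ·L^ε_p(E)) = 0` for the sign used — per pair ONE unit coefficient, class-wide
  Pollack's conjecture (OPEN): the honest residue of this line, shared in kind with `unitseed-fouquet`.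
* `stub_three` — RESIDUE `p = 3` of THIS line is BOOKKEEPING, not engine: Kato at `3` on X7 ∧ `Surj`
  (`surjective_pow_of_surj_of_good`), Hatley–Lei (`p` odd, `k = 2 ≤ p`) and Fouquet (his worked example is
  `p = 3`, `a_3 = 0`) all run at `3`; but `SL₂(𝔽_3)^{ab} = ℤ/3` cuts out `ℚ(ζ_3, Δ_E^{1/3}) ⊂ ℚ(E[3])`, so a useful
  prime CANNOT split every `q ∣ N`: exactly the primes `q₀` with `3 ∤ v_{q₀}(Δ)` may stay inert in `ℚ(χ)`, and
  the forced valuation becomes `ν(n) + 2t − [q₀ of type IV/IV* with c_{q₀} = 3]` (unchanged when some `q₀` with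
  `3 ∤ v_{q₀}(Δ)` has `Φ_{q₀}[3] = 0`: types I_m, I*_m (`3 ∤ m`), II, II*). To be typed by the plan seat.
Composition: `lowerHalf_of_stubs` (an odd prime is `3` or `≥ 5`; at `p ≥ 5` take the witness, split on
`Assumption34TateAt p W`) and `KobayashiLowerHalfLargeImage_of : <the crux>` from the four registered stubs.
-/

set_option autoImplicit false

noncomputable section

open scoped Classical MatrixGroups ModularForm

open CongruenceSubgroup WeierstrassCurve Literature.NumberTheory.EllipticCurves
  Literature.NumberTheory.EllipticCurves.ModularForms
  Literature.NumberTheory.EllipticCurves.Rank1Residual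
  Literature.NumberTheory.EllipticCurves.Rank1Residual.Typed
  Literature.NumberTheory.EllipticCurves.Fouquet2025
  Summit.BirchSwinnertonDyer.Rank1Residual.Supersingular

namespace Summit.BirchSwinnertonDyer.BirchSwinnertonDyer.Cruxes.KobayashiLowerHalfLargeImage

namespace StableTwistSeed

/-- `ζ_p ∈ ℚ(ζ_p)`: the distinguished primitive `p`-th root of unity of `CyclotomicField p ℚ`. -/
def zetaP (p : ℕ) [NeZero p] : CyclotomicField p ℚ :=
  haveI : NeZero ((p : ℕ) : ℚ) := NeZero.charZero
  haveI : IsCyclotomicExtension {p} ℚ (CyclotomicField p ℚ) :=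
    CyclotomicField.isCyclotomicExtension p ℚ
  IsCyclotomicExtension.zeta p ℚ (CyclotomicField p ℚ)

/-- The TWISTED THETA VALUE `χ_ψ(θ_n) = Σ_{a ∈ (ℤ/n)ˣ} [a/n]⁺_f · ζ_p^{Σ_{ℓ∣n} ψ_ℓ(a)} ∈ ℚ(ζ_p)`: the
Mazur–Tate modular element `θ_n = Σ_a [a/n]⁺ σ_a` of the newform `f` (rational plus symbols, period `Ω⁺_f`,
tree `ratPlusSymbol`) evaluated at the character `χ_ψ(a) = ζ_p^{Σ_ℓ ψ_ℓ(a mod ℓ)}` of `(ℤ/n)ˣ` built from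
discrete logarithms `ψ_ℓ : (ℤ/ℓ)ˣ → ℤ/p` — of order `p` and conductor `n` when `n` is square-free and every
`ψ_ℓ` is onto. By Birch's formula this is `𝓛(E, χ̄_ψ)` = (Gauss sum) · `L(E, χ̄_ψ, 1)/Ω⁺` up to sign
conventions (Mazur–Tate–Teitelbaum 1986 §I.8; Wiersema–Wuthrich 2022 §2). Same summand shape as `kuriharaNumber`. -/
def twistedThetaValue {N : ℕ} (f : CuspForm (Gamma0 N) 2) (p n : ℕ) [NeZero p] [NeZero n]
    (ψ : (ℓ : ℕ) → (ZMod ℓ)ˣ →* Multiplicative (ZMod p)) : CyclotomicField p ℚ :=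
  ∑ a : (ZMod n)ˣ, (ratPlusSymbol f (((a : ZMod n).val : ℚ) / n) : CyclotomicField p ℚ) *
    ∏ ℓ ∈ n.primeFactors.attach,
      zetaP p ^ (Multiplicative.toAdd (ψ ℓ.1 (ZMod.unitsMap (Nat.dvd_of_mem_primeFactors ℓ.2) a))).val

/-- «`v_𝔭(x) = e`» for `𝔭 = (1 - ζ_p)`, the unique prime of `ℤ[ζ_p]` above `p` (totally ramified,
`v_𝔭(p) = p - 1`), spelled elementarily: after clearing a denominator `D` prime to `p`, `D·x = (1-ζ_p)^e · y`
with `y ∈ ℤ[ζ_p]` not divisible by `1 - ζ_p` in `ℤ[ζ_p]`. -/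
def HasPrimeValuation (p : ℕ) [NeZero p] (x : CyclotomicField p ℚ) (e : ℕ) : Prop :=
  ∃ (D : ℕ) (y : CyclotomicField p ℚ), ¬ p ∣ D ∧
    y ∈ Algebra.adjoin ℤ ({zetaP p} : Set (CyclotomicField p ℚ)) ∧
    (∀ z ∈ Algebra.adjoin ℤ ({zetaP p} : Set (CyclotomicField p ℚ)), y ≠ (1 - zetaP p) * z) ∧
    (D : CyclotomicField p ℚ) * x = (1 - zetaP p) ^ e * y

/-- A STABLE TWIST LEVEL for `(E, p)`: a cyclic Kolyvagin level `n` (tree `IsCyclicKolyvaginLevel W p n`: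
`n` square-free, every `ℓ ∣ n` has `ℓ ∤ Np`, `ℓ ≡ 1`, `a_ℓ ≡ 2 (mod p)` and `Ẽ(𝔽_ℓ)[p]` cyclic — i.e.
`Frob_ℓ` has order exactly `p` on `E[p]`, KMR's `𝒫₁`) at each of whose primes `p` and every prime `q` of the
conductor are `p`-th powers mod `ℓ` (so `p` and the bad primes split completely in the degree-`p` field
`ℚ(χ) ⊂ ℚ(μ_n)`). -/
def IsStableTwistLevel (W : WeierstrassCurve ℚ) [W.IsGloballyMinimal] (p n : ℕ) : Prop :=
  IsCyclicKolyvaginLevel W p n ∧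
    ∀ ℓ ∈ n.primeFactors, (∃ x : ZMod ℓ, x ^ p = (p : ZMod ℓ)) ∧
      ∀ q ∈ (W.conductorNorm ℤ).primeFactors, ∃ y : ZMod ℓ, y ^ p = (q : ZMod ℓ)

/-- A STABLE TWIST WITNESS for `(E, p)` and the newform `f` of `E`: a stable twist level `n`, onto discrete
logarithms `ψ_ℓ : (ℤ/ℓ)ˣ ↠ ℤ/p` at the primes of `n` (a fully ramified order-`p` character `χ_ψ` of conductor
`n`), and the EXACT valuation `v_{(1-ζ_p)} χ_ψ(θ_n) = ν(n) + (p-1)·ord_p ∏_ℓ c_ℓ(E)` — the value forced by BSD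
for the rank-`0`, `Ш[𝔭^∞]`-trivial twist `A_χ` (one `𝔭`-length per twisting prime, `(p-1)·ord_p c_q` per bad
prime of `E`, nothing at the supersingular prime `p`). -/
def StableTwistWitness (W : WeierstrassCurve ℚ) [W.IsGloballyMinimal] (p : ℕ) [Fact p.Prime]
    {N : ℕ} (f : CuspForm (Gamma0 N) 2) : Prop :=
  haveI : NeZero p := ⟨(Fact.out : p.Prime).ne_zero⟩
  ∃ (n : ℕ) (_ : NeZero n) (ψ : (ℓ : ℕ) → (ZMod ℓ)ˣ →* Multiplicative (ZMod p)),
    IsStableTwistLevel W p n ∧ (∀ ℓ ∈ n.primeFactors, Function.Surjective (ψ ℓ)) ∧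
      HasPrimeValuation p (twistedThetaValue f p n ψ)
        (n.primeFactors.card + (p - 1) * padicValNat p W.tamagawaProduct)

/-- THE HARD STUB (class-wide, `p ≥ 5`): on the large-image corner of X7 (good supersingular `p`, `E` not
semistable, non-CM, `a_p = 0`, `ρ̄_{E,p}` onto) the newform `f` of `E` admits a stable twist witness — some
Selmer-killing order-`p` twist `A_χ` has its central value EXACTLY as divisible as BSD(`A_χ/ℚ`) forces.
Existence of stable Selmer-killing levels: Klagsbrun–Mazur–Rubin, Compositio 150 (2014) Prop. 46(ii),
47(ii) with Mazur–Rubin 2004 Prop. 3.6.1 (Čebotarev; the splitting conditions are compatible because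
`SL₂(𝔽_p)` is perfect for `p ≥ 5`); the exact value: Dokchitser–Evans–Wiersema, Crelle 2021, Conj. 4 / Thm. 7;
integrality: Wiersema–Wuthrich, Doc. Math. 27 (2022) Thm. 2. Per pair DECIDABLE by one modular-symbol sum
(which simultaneously certifies `Sel_𝔭(A_χ) = 0` through Kato); class-wide OPEN. -/
theorem stub_stableTwistExact :
    ∀ (W : WeierstrassCurve ℚ) [W.IsElliptic] [W.IsGloballyMinimal] (p : ℕ) [Fact p.Prime],
      5 ≤ p → ClassX7 W p → ¬ W.HasCM → W.frobeniusTrace p = 0 → Surj W p →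
      ∀ [NeZero (W.conductorNorm ℤ)] (f : CuspForm (Gamma0 (W.conductorNorm ℤ)) 2),
        IsNewformOf W f → StableTwistWitness W p f := by
  sorry

/-- ENGINE + FOUQUET TRANSPORT (published inputs), `p ≥ 5`, good supersingular `p` with `a_p = 0`, non-CM,
`ρ̄` onto, and Fouquet's Ass. 3.4 at the `ρ̄`-unramified Tate primes of `E`: a stable twist witness for the
newform gives Kobayashi's main conjecture for BOTH signs. Chain: Kato 2004 Thm 12.5 for `f⊗χ` + Kobayashi
2003 / Lei 2011 (`±` Coleman maps, `a_p(f⊗χ) = 0`) ⇒ `char X^ε(f⊗χ) ∣ ϖ L^ε_p(f⊗χ)`; B. D. Kim 2013 (`±`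
control at `T = 0`, no finite submodules) + the witness ⇒ equality at `T = 0` ⇒ unit quotient
(`span_eq_of_dvd_of_associated_constantCoeff`) ⇒ signed IMC for `f⊗χ`; Fouquet 2025 Thm 4.1 (1)⇒(2) with the
motivic seed `f⊗χ ≡ f (mod 𝔭)` (Ass. 2.9 ⇐ `Surj` ∧ supersingular; Ass. 3.4 (5)(b)/(c) at `ℓ ∣ n`; `Assumption34TateAt`
at Tate primes) ⇒ Kato's IMC for `f` ⇒ Kobayashi 2003 Thm 7.4 ⇒ both signed main conjectures for `E`. -/
theorem stub_signedMC_of_stableTwist_fouquet :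
    ∀ (W : WeierstrassCurve ℚ) [W.IsElliptic] [W.IsGloballyMinimal] (p : ℕ) [Fact p.Prime],
      5 ≤ p → W.HasGoodReductionAtPrime p → W.frobeniusTrace p = 0 → ¬ W.HasCM → Surj W p →
      Assumption34TateAt p W →
      (∀ [NeZero (W.conductorNorm ℤ)] (f : CuspForm (Gamma0 (W.conductorNorm ℤ)) 2),
          IsNewformOf W f → StableTwistWitness W p f) →
      ∀ ε : ℤˣ, KobayashiMainConjecture W p ε := by
  sorry

/-- ENGINE + SIGNED RESIDUAL TRANSPORT on the Fouquet-INELIGIBLE pairs of the corner (`p ≥ 5`): the signed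
main conjectures for `f⊗χ` (as in the previous stub, steps (i)–(iii)) are moved to `f` along
`A_χ[𝔭] ≅ E[p]` with the SAME `±` local condition at `p` (B. D. Kim, Asian J. Math. 13 (2009); Hatley–Lei,
Ann. Inst. Fourier 69 (2019) Thm 4.6; Ray–Sujatha, Canad. J. Math. (2023) Thm 4.5): algebraic and analytic
`λ`-invariants agree across the congruence once `μ = 0` on one side, and `μ(ϖ·L^ε_p(E)) = 0` for the sign
used is read off ONE unit coefficient per pair (class-wide: Pollack's `μ^± = 0` conjecture, OPEN — the honest
residue of this line). Conclusion: the Eisenstein half for some sign. -/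
theorem stub_lowerHalf_of_stableTwist_ineligible :
    ∀ (W : WeierstrassCurve ℚ) [W.IsElliptic] [W.IsGloballyMinimal] (p : ℕ) [Fact p.Prime],
      5 ≤ p → ClassX7 W p → ¬ W.HasCM → W.frobeniusTrace p = 0 → Surj W p →
      ¬ Assumption34TateAt p W →
      (∀ [NeZero (W.conductorNorm ℤ)] (f : CuspForm (Gamma0 (W.conductorNorm ℤ)) 2),
          IsNewformOf W f → StableTwistWitness W p f) →
      ∃ ε : ℤˣ, KobayashiLowerDivisibility W p ε := by
  sorry

/-- RESIDUE `p = 3` (bookkeeping, not engine): the crux's conclusion at `3` on the corner. The twist-seed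
chain runs at `3` (Kato at `3` under `Surj` ∧ good: `surjective_pow_of_surj_of_good`; Hatley–Lei: `p` odd;
Fouquet's worked example is `p = 3`, `a_3 = 0`), but `ℚ(ζ_3, Δ_E^{1/3}) ⊂ ℚ(E[3])` forbids a useful prime from
splitting every bad prime, so the stable level keeps the primes `q₀ ∣ N` with `3 ∤ v_{q₀}(Δ)` inert in `ℚ(χ)` and
the forced valuation is `ν(n) + 2·ord_3 Tam(E) − [q₀ of type IV/IV*, c_{q₀} = 3]`; left to the plan seat to type. -/
theorem stub_three :
    ∀ (W : WeierstrassCurve ℚ) [W.IsElliptic] [W.IsGloballyMinimal] (p : ℕ) [Fact p.Prime],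
      p = 3 → ClassX7 W p → ¬ W.HasCM → W.frobeniusTrace p = 0 → Surj W p →
      ∃ ε : ℤˣ, KobayashiLowerDivisibility W p ε := by
  sorry

/-- COMPOSITION, explicit form (bookkeeping; conclusion = the crux UNFOLDED): an odd prime is `3` or `≥ 5`;
at `p ≥ 5` the hard stub supplies a stable twist witness for every newform of `E`; on Fouquet-eligible pairs the
engine gives Kobayashi's main conjecture for every sign, whence the Eisenstein half for `ε = 1`
(`kobayashiLowerDivisibility_of_mainConjecture`); on the ineligible pairs the signed residual transport gives
the Eisenstein half for some sign directly; `p = 3` is the residue stub. -/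
theorem lowerHalf_of_stubs
    (hW : ∀ (W : WeierstrassCurve ℚ) [W.IsElliptic] [W.IsGloballyMinimal] (p : ℕ) [Fact p.Prime],
      5 ≤ p → ClassX7 W p → ¬ W.HasCM → W.frobeniusTrace p = 0 → Surj W p →
      ∀ [NeZero (W.conductorNorm ℤ)] (f : CuspForm (Gamma0 (W.conductorNorm ℤ)) 2),
        IsNewformOf W f → StableTwistWitness W p f)
    (hF : ∀ (W : WeierstrassCurve ℚ) [W.IsElliptic] [W.IsGloballyMinimal] (p : ℕ) [Fact p.Prime],
      5 ≤ p → W.HasGoodReductionAtPrime p → W.frobeniusTrace p = 0 → ¬ W.HasCM → Surj W p →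
      Assumption34TateAt p W →
      (∀ [NeZero (W.conductorNorm ℤ)] (f : CuspForm (Gamma0 (W.conductorNorm ℤ)) 2),
          IsNewformOf W f → StableTwistWitness W p f) →
      ∀ ε : ℤˣ, KobayashiMainConjecture W p ε)
    (hI : ∀ (W : WeierstrassCurve ℚ) [W.IsElliptic] [W.IsGloballyMinimal] (p : ℕ) [Fact p.Prime],
      5 ≤ p → ClassX7 W p → ¬ W.HasCM → W.frobeniusTrace p = 0 → Surj W p →
      ¬ Assumption34TateAt p W →
      (∀ [NeZero (W.conductorNorm ℤ)] (f : CuspForm (Gamma0 (W.conductorNorm ℤ)) 2),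
          IsNewformOf W f → StableTwistWitness W p f) →
      ∃ ε : ℤˣ, KobayashiLowerDivisibility W p ε)
    (h3 : ∀ (W : WeierstrassCurve ℚ) [W.IsElliptic] [W.IsGloballyMinimal] (p : ℕ) [Fact p.Prime],
      p = 3 → ClassX7 W p → ¬ W.HasCM → W.frobeniusTrace p = 0 → Surj W p →
      ∃ ε : ℤˣ, KobayashiLowerDivisibility W p ε) :
    ∀ (W : WeierstrassCurve ℚ) [W.IsElliptic] [W.IsGloballyMinimal] (p : ℕ) [Fact p.Prime],
      p ≠ 2 → ClassX7 W p → ¬ W.HasCM → W.frobeniusTrace p = 0 → Surj W p →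
      ∃ ε : ℤˣ, KobayashiLowerDivisibility W p ε := by
  intro W _ _ p _ hp2 hX hcm hap hs
  have hpP : p.Prime := Fact.out
  by_cases hp5 : 5 ≤ p
  · have hw : ∀ [NeZero (W.conductorNorm ℤ)] (f : CuspForm (Gamma0 (W.conductorNorm ℤ)) 2),
        IsNewformOf W f → StableTwistWitness W p f :=
      fun f hf => hW W p hp5 hX hcm hap hs f hf
    by_cases hT : Assumption34TateAt p W
    · exact ⟨1, kobayashiLowerDivisibility_of_mainConjecture
        (hF W p hp5 hX.1.1 hap hcm hs hT (fun f hf => hw f hf) 1)⟩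
    · exact hI W p hp5 hX hcm hap hs hT (fun f hf => hw f hf)
  · have hp3 : p = 3 := by
      have h2 := hpP.two_le
      interval_cases p
      · exact absurd rfl hp2
      · rfl
      · exact absurd hpP (by decide)
    exact h3 W p hp3 hX hcm hap hs

/-- THE SKELETON: the crux BY NAME from exactly the four registered stubs (no sorry of its own; the stubs'
`sorry`s are the line's open obligations). -/
theorem KobayashiLowerHalfLargeImage_of :
    Summit.BirchSwinnertonDyer.BirchSwinnertonDyer.Theses.SignedLowerHalves.KobayashiLowerHalfLargeImage :=
  lowerHalf_of_stubs stub_stableTwistExact stub_signedMC_of_stableTwist_fouquet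
    stub_lowerHalf_of_stableTwist_ineligible stub_three

end StableTwistSeed

end Summit.BirchSwinnertonDyer.BirchSwinnertonDyer.Cruxes.KobayashiLowerHalfLargeImage

end
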